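import Literature.IUT.HodgeTheaters.StableCurveTemperedDataOfSpecialFibreCor25XRoute
import Literature.IUT.HodgeTheaters.StableCurveTemperedDataOfSpecialFibreSec2HTFOfFreePro
import HarnessLib

/-!
# The §2 one-call's last LAW, stated by its content: (A3-arith)_j over FREE node data is the E-free
# temperedness transfer (A3′)_j ([IUTchI] Prop. 2.4 (ii), p. 51 l. 1–4)

S. Mochizuki, *Inter-universal Teichmüller theory I*, kurims manuscript (May 2020), §2, proof of Prop. 2.4 (ii), p. 50
l. 52 – p. 51 l. 13: "when one applies either [AbsTopII], Proposition 1.3, (iv), or [NodNon], Proposition 3.9, (i) … to the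
vertices “`v″`”, “`(v′)^γ`”, one may only conclude that these two vertices either *coincide*, *are adjacent*, or *admit a
common adjacent vertex*; but this is still sufficient to conclude the *temperedness* of “`(v′)^γ`” from that of “`v″`”"
[cite: Mochizuki2012, Prop 2.4(ii) pp.50-51] (D-0012 claim key; series status DISPUTED — nothing of the series is asserted
here); S. Mochizuki, *Topics in Absolute Anabelian Geometry II*, Prop. 1.3 (iv) p. 11 [cite: MochizukiAbsTopII2013,
Prop 1.3 (iv) p.11]; Y. Hoshi–S. Mochizuki, *On the combinatorial anabelian geometry of nodally nondegenerate outer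
representations* [NodNon], Prop. 3.9 (i).

PROOF-ONLY file (abc-iut cell, L5 [IUTchI] §2 lineage; seat abc-iut-w4-d058 gen 11, self-named support row
«SEC2-A3PRIME-EFREE»; no definition, no instance, no notation, no new `Prop` fact).  STATE OF RECORD (abc-iut-L5-lead
RULINGS #119 (3)): the §2 one-call of [IUTchI] Prop. 2.4 (i)(ii)(iii) ∧ Cor. 2.5 at the genuine 𝔛-datum
(`prop24_cor25_ofPiData_byName_noRF_frame`, abc-iut-L5-t11 p493190; (x′)-keyed `…_of_isFreeOrSurface`, abc-iut-w4-d058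
p496462; (x)-keyed `…_of_freePro`, abc-iut-L5-t11 p496636) carries FIVE laws `hNN_i · hab · hadm · hI_j^frame · hA3ar_j`,
of which `hA3ar_j` — (A3-arith)_j "in coset coordinates on the pro-tree" — is the ONE law with neither a FACT nor a GAP
name.  OBSERVATION, made kernel-exact here: `hA3ar_j` is stated relative to NODE DATA `{EA j} (srcA tgtA : EA j → V j)
(c₁A c₂A : EA j → Π^tp_j)` which are FREE binders of the one-call (no hypothesis ties them to the edges / branches of the
level-`j` decomposition data `Dd j`).  Consequently:

* § A (generic group algebra, any `ι : Π^tp → Π̂`, any family of "verticial" subgroups `P_v ≤ ι(Π^tp)`, ANY node data):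
  the coset-tree disjunction "coincide ∨ adjacent ∨ common adjacent vertex" for the pro-vertices `(v, g)`, `(w, h)`
  IMPLIES `g⁻¹h ∈ ι(Π^tp)` (`inv_mul_mem_range_of_cosetTreeNear`; the verticial groups and the branch conjugators are
  tempered) — and CONVERSELY `g⁻¹h ∈ ι(Π^tp)` implies the disjunction for the node datum
  `E⋆ := V × V × Π^tp`, `src/tgt :=` the projections, `c₁ := 1`, `c₂ :=` the third coordinate
  (`cosetTreeNear_of_inv_mul_mem_range`: the "edge" `(v, w, t)` with `ι t = g⁻¹h`);
* § B (the genuine 𝔛-datum over `P : SpecialFibreTower.PiData`): hence `hA3ar_j(E)` implies, for EVERY node datum `E`,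
  the E-free law **(A3′)_j** «if a `Π̂_j`-conjugate `γΛ̄γ⁻¹` of the image of a compact open-image `Λ ≤ Π^temp_{X_K}` lies in
  `g·ι(D_v)·g⁻¹` and in `h·ι(D_w)·h⁻¹` (`g, h ∈ Π̂_j`; `D_v, D_w` level-`j` verticial decomposition groups of `Dd j`), then
  `g⁻¹h ∈ ι(Π^tp_j)`» (`A3prime_of_hA3ar`), and the three one-calls hold with `hA3ar_j ↦ (A3′)_j` and the five node-data
  binders ELIMINATED (`prop24_cor25_ofPiData_byName_noRF_frame_A3prime`, `…_of_isFreeOrSurface_A3prime`,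
  `…_of_freePro_A3prime`).  Law count UNCHANGED (5); the law is now named by its content — the temperedness transfer
  between `Π̂_j`-conjugates of verticial decomposition groups sharing an arithmetically ample compact subgroup, i.e. the
  USE print makes of [AbsTopII] Prop. 1.3 (iv) / [NodNon] Prop. 3.9 (i) on p. 51 l. 1–4, not the trichotomy itself.

HONEST TAGS.  Nothing of [AbsTopII] Prop. 1.3 (iv) / [NodNon] Prop. 3.9 (i) is proved; (A3′)_j stays a LAW (a displayed
hypothesis).  TYPING NOTE (not a defect of any landed theorem — a stronger law only weakens a one-call): a print-faithful
(A3)_j would bind the node data to `(Dd j)`'s own edges and branch groups with THEIR tempered branch conjugators; over the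
free binder of record nothing is lost by (A3′)_j.  CONDITIONAL as labelled; typed ≠ inhabited ≠ discharged; nothing here
asserts that abc is proved or refuted, and nothing here bears on [IUTchIII] Cor. 3.12.
-/

noncomputable section

namespace Literature.IUT.HodgeTheaters

open _root_.Topology
open scoped Pointwise
open Literature.AnabelianGeometry.SemiGraphs Literature.AnabelianGeometry.SemiGraphs.ProfiniteSemiGraph
open Literature.AnabelianGeometry.SemiGraphs.SemiGraphOfAnabelioids (IsProSigmaCompletion)

namespace StableCurveTemperedData

namespace OfSpecialFibre

/-! ### A. Generic: the coset-tree nearness disjunction versus the E-free temperedness transfer -/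

section Generic

variable {Tp Hat : Type*} [Group Tp] [Group Hat] (ι : Tp →* Hat) {V : Type*} (Pv : V → Subgroup Hat)

/-- **ADJACENT pro-vertices differ by a tempered element.**  In coset coordinates: if `(v, g)`, `(w, h)` are the
end-points `k·ι(c₁ e)·p`, `k·ι(c₂ e)·q` (`p ∈ P_{src e}`, `q ∈ P_{tgt e}`, in either order) of a node, the verticial groups
`P_u ≤ ι(Π^tp)` and the branch conjugators `c₁ e, c₂ e ∈ Π^tp` being tempered, then `g⁻¹h ∈ ι(Π^tp)` — for ANY node data
`E, src, tgt, c₁, c₂`. ([IUTchI] Prop 2.4(ii) p.51) [claim: Mochizuki2012, status: disputed] -/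
theorem inv_mul_mem_range_of_cosetTreeAdjacent (hPv : ∀ v, Pv v ≤ ι.range) {E : Type*} (src tgt : E → V)
    (c₁ c₂ : E → Tp) {v w : V} {g h : Hat}
    (hadj : ∃ (e : E) (k : Hat), ∃ p ∈ Pv (src e), ∃ q ∈ Pv (tgt e),
      (src e = v ∧ tgt e = w ∧ g = k * ι (c₁ e) * p ∧ h = k * ι (c₂ e) * q) ∨
      (src e = w ∧ tgt e = v ∧ h = k * ι (c₁ e) * p ∧ g = k * ι (c₂ e) * q)) :
    g⁻¹ * h ∈ ι.range := by
  obtain ⟨e, k, p, hp, q, hq, hcase⟩ := hadj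
  have hp' : p ∈ ι.range := hPv _ hp
  have hq' : q ∈ ι.range := hPv _ hq
  have hc₁ : ι (c₁ e) ∈ ι.range := MonoidHom.mem_range.mpr ⟨c₁ e, rfl⟩
  have hc₂ : ι (c₂ e) ∈ ι.range := MonoidHom.mem_range.mpr ⟨c₂ e, rfl⟩
  rcases hcase with ⟨-, -, rfl, rfl⟩ | ⟨-, -, rfl, rfl⟩
  · have hrw : (k * ι (c₁ e) * p)⁻¹ * (k * ι (c₂ e) * q) = p⁻¹ * ((ι (c₁ e))⁻¹ * ι (c₂ e)) * q := by
      group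
    rw [hrw]
    exact mul_mem (mul_mem (inv_mem hp') (mul_mem (inv_mem hc₁) hc₂)) hq'
  · have hrw : (k * ι (c₂ e) * q)⁻¹ * (k * ι (c₁ e) * p) = q⁻¹ * ((ι (c₂ e))⁻¹ * ι (c₁ e)) * p := by
      group
    rw [hrw]
    exact mul_mem (mul_mem (inv_mem hq') (mul_mem (inv_mem hc₂) hc₁)) hp'

/-- **The coset-tree nearness disjunction implies the temperedness transfer**, for ANY node data: if the pro-vertices
`(v, g)`, `(w, h)` "coincide (`v = w`, `g⁻¹h ∈ P_v`), are adjacent, or admit a common adjacent pro-vertex `(u, f)`"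
(the (A3-arith) disjunction of the §2 one-call, [AbsTopII] Prop 1.3 (iv) / [NodNon] Prop 3.9 (i) in coset form), then
`g⁻¹h ∈ ι(Π^tp)`. ([IUTchI] Prop 2.4(ii) p.51) [claim: Mochizuki2012, status: disputed] -/
theorem inv_mul_mem_range_of_cosetTreeNear (hPv : ∀ v, Pv v ≤ ι.range) {E : Type*} (src tgt : E → V)
    (c₁ c₂ : E → Tp) {v w : V} {g h : Hat}
    (hnear : (v = w ∧ g⁻¹ * h ∈ Pv v) ∨
      (∃ (e : E) (k : Hat), ∃ p ∈ Pv (src e), ∃ q ∈ Pv (tgt e),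
        (src e = v ∧ tgt e = w ∧ g = k * ι (c₁ e) * p ∧ h = k * ι (c₂ e) * q) ∨
        (src e = w ∧ tgt e = v ∧ h = k * ι (c₁ e) * p ∧ g = k * ι (c₂ e) * q)) ∨
      (∃ (u : V) (f : Hat),
        (∃ (e : E) (k : Hat), ∃ p ∈ Pv (src e), ∃ q ∈ Pv (tgt e),
          (src e = v ∧ tgt e = u ∧ g = k * ι (c₁ e) * p ∧ f = k * ι (c₂ e) * q) ∨
          (src e = u ∧ tgt e = v ∧ f = k * ι (c₁ e) * p ∧ g = k * ι (c₂ e) * q)) ∧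
        (∃ (e : E) (k : Hat), ∃ p ∈ Pv (src e), ∃ q ∈ Pv (tgt e),
          (src e = u ∧ tgt e = w ∧ f = k * ι (c₁ e) * p ∧ h = k * ι (c₂ e) * q) ∨
          (src e = w ∧ tgt e = u ∧ h = k * ι (c₁ e) * p ∧ f = k * ι (c₂ e) * q)))) :
    g⁻¹ * h ∈ ι.range := by
  rcases hnear with ⟨-, hmem⟩ | hadj | ⟨u, f, h1, h2⟩
  · exact hPv v hmem
  · exact inv_mul_mem_range_of_cosetTreeAdjacent ι Pv hPv src tgt c₁ c₂ hadj
  · have e1 : g⁻¹ * f ∈ ι.range := inv_mul_mem_range_of_cosetTreeAdjacent ι Pv hPv src tgt c₁ c₂ h1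
    have e2 : f⁻¹ * h ∈ ι.range := inv_mul_mem_range_of_cosetTreeAdjacent ι Pv hPv src tgt c₁ c₂ h2
    have hrw : g⁻¹ * h = g⁻¹ * f * (f⁻¹ * h) := by group
    rw [hrw]
    exact mul_mem e1 e2

/-- **Conversely, the temperedness transfer gives the disjunction for the node datum `E⋆ := V × V × Π^tp`**
(`src`/`tgt` the projections, `c₁ := 1`, `c₂ :=` the third coordinate): if `ι t = g⁻¹h` then `(v, g)`, `(w, h)` are
"adjacent" along the `E⋆`-node `(v, w, t)` with `k := g`, `p := q := 1`.  So over FREE node data the (A3-arith)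
disjunction carries exactly the content `g⁻¹h ∈ ι(Π^tp)`. ([IUTchI] Prop 2.4(ii) p.51) [claim: Mochizuki2012, status: disputed] -/
theorem cosetTreeNear_of_inv_mul_mem_range {v w : V} {g h : Hat} (hgh : g⁻¹ * h ∈ ι.range) :
    (v = w ∧ g⁻¹ * h ∈ Pv v) ∨
      (∃ (e : V × V × Tp) (k : Hat), ∃ p ∈ Pv e.1, ∃ q ∈ Pv e.2.1,
        (e.1 = v ∧ e.2.1 = w ∧ g = k * ι 1 * p ∧ h = k * ι e.2.2 * q) ∨
        (e.1 = w ∧ e.2.1 = v ∧ h = k * ι 1 * p ∧ g = k * ι e.2.2 * q)) ∨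
      (∃ (u : V) (f : Hat),
        (∃ (e : V × V × Tp) (k : Hat), ∃ p ∈ Pv e.1, ∃ q ∈ Pv e.2.1,
          (e.1 = v ∧ e.2.1 = u ∧ g = k * ι 1 * p ∧ f = k * ι e.2.2 * q) ∨
          (e.1 = u ∧ e.2.1 = v ∧ f = k * ι 1 * p ∧ g = k * ι e.2.2 * q)) ∧
        (∃ (e : V × V × Tp) (k : Hat), ∃ p ∈ Pv e.1, ∃ q ∈ Pv e.2.1,
          (e.1 = u ∧ e.2.1 = w ∧ f = k * ι 1 * p ∧ h = k * ι e.2.2 * q) ∨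
          (e.1 = w ∧ e.2.1 = u ∧ h = k * ι 1 * p ∧ f = k * ι e.2.2 * q))) := by
  obtain ⟨t, ht⟩ := MonoidHom.mem_range.mp hgh
  refine Or.inr (Or.inl ⟨(v, w, t), g, 1, one_mem _, 1, one_mem _, Or.inl ⟨rfl, rfl, ?_, ?_⟩⟩)
  · rw [map_one, mul_one, mul_one]
  · rw [mul_one, ht, mul_inv_cancel_left]

end Generic

/-! ### B. The genuine 𝔛-datum over `P`: `hA3ar_j(E) ⇒ (A3′)_j` for every `E`, and the one-calls re-keyed -/

variable {p : ℕ} [Fact p.Prime] (X : TemperedCurve p) (d : X.GroupLevelData)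
  (T : SpecialFibreTower X.DeltaTemp)
  (Sigma SigmaHat : Set ℕ) (hsub : Sigma ⊆ SigmaHat) (hne : Set.Nonempty Sigma)
  (hprime : ∀ q ∈ SigmaHat, q.Prime)
  (S : SpecialFibreData (X.toTemperedArithmeticGroup d)) (h36 : S.Gc.Prop36Hypotheses)
  (hp : p ∉ Sigma) (TpH : Subgroup S.chart.G)
  (HatH : Subgroup (TemperedGraphGroupData.exists_completion_of_prop36 S.Gc h36 S.chart).choose)
  (hle : TpH.map (TemperedGraphGroupData.exists_completion_of_prop36 S.Gc h36
    S.chart).choose_spec.choose.toMonoidHom ≤ HatH)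
  (cuspMeetsH : {x : X.Pt // X.IsCusp x} → Prop)

/-- **`hA3ar_j(E) ⇒ (A3′)_j` for EVERY node datum `E`** at the genuine quotient tower over `P`: the (A3-arith)_j binder of
the §2 one-calls of record (p493190 / p496462 / p496636), for whatever node data `{EA} srcA tgtA c₁A c₂A` it is stated,
implies the E-free temperedness transfer «`γΛ̄γ⁻¹ ≤ g·ι(D_v)·g⁻¹` and `≤ h·ι(D_w)·h⁻¹` ⇒ `g⁻¹h ∈ ι(Π^tp_j)`».
([IUTchI] Prop 2.4(ii) p.51) [claim: Mochizuki2012, status: disputed] -/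
theorem A3prime_of_hA3ar (P : SpecialFibreTower.PiData X d S T) {V B : ℕ → Type*}
    (Dd : ∀ j, DecompositionData ((qTowerOfSpecialFibreTower X T d S h36 Sigma SigmaHat hsub hne hprime hp TpH HatH hle cuspMeetsH P.admKer_normal_pi).Q j).Tp (V j) (B j))
    {EA : ℕ → Type*} (srcA tgtA : ∀ j, EA j → V j)
    (c₁A c₂A : ∀ j, EA j → ((qTowerOfSpecialFibreTower X T d S h36 Sigma SigmaHat hsub hne hprime hp TpH HatH hle cuspMeetsH P.admKer_normal_pi).Q j).Tp)
    (hA3ar : ∀ (j : ℕ) (Λ : Subgroup X.PiTemp), IsCompact (Λ : Set X.PiTemp) → Λ ≠ ⊥ →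
      IsOpen (Λ.map X.augGK.toMonoidHom : Set X.GK) →
      ∀ (v w : V j) (g h γ : ((qTowerOfSpecialFibreTower X T d S h36 Sigma SigmaHat hsub hne hprime hp TpH HatH hle cuspMeetsH P.admKer_normal_pi).Q j).Hat),
        MulAut.conj γ • Λ.map (((qTowerOfSpecialFibreTower X T d S h36 Sigma SigmaHat hsub hne hprime hp TpH HatH hle cuspMeetsH P.admKer_normal_pi).qhat j).comp X.toHat.toMonoidHom) ≤
            MulAut.conj g • ((Dd j).vertGp v).map ((qTowerOfSpecialFibreTower X T d S h36 Sigma SigmaHat hsub hne hprime hp TpH HatH hle cuspMeetsH P.admKer_normal_pi).Q j).ι →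
        MulAut.conj γ • Λ.map (((qTowerOfSpecialFibreTower X T d S h36 Sigma SigmaHat hsub hne hprime hp TpH HatH hle cuspMeetsH P.admKer_normal_pi).qhat j).comp X.toHat.toMonoidHom) ≤
            MulAut.conj h • ((Dd j).vertGp w).map ((qTowerOfSpecialFibreTower X T d S h36 Sigma SigmaHat hsub hne hprime hp TpH HatH hle cuspMeetsH P.admKer_normal_pi).Q j).ι →
          (v = w ∧ g⁻¹ * h ∈ ((Dd j).vertGp v).map ((qTowerOfSpecialFibreTower X T d S h36 Sigma SigmaHat hsub hne hprime hp TpH HatH hle cuspMeetsH P.admKer_normal_pi).Q j).ι) ∨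
          (∃ (e : EA j) (k : ((qTowerOfSpecialFibreTower X T d S h36 Sigma SigmaHat hsub hne hprime hp TpH HatH hle cuspMeetsH P.admKer_normal_pi).Q j).Hat),
            ∃ p ∈ ((Dd j).vertGp (srcA j e)).map ((qTowerOfSpecialFibreTower X T d S h36 Sigma SigmaHat hsub hne hprime hp TpH HatH hle cuspMeetsH P.admKer_normal_pi).Q j).ι,
            ∃ q ∈ ((Dd j).vertGp (tgtA j e)).map ((qTowerOfSpecialFibreTower X T d S h36 Sigma SigmaHat hsub hne hprime hp TpH HatH hle cuspMeetsH P.admKer_normal_pi).Q j).ι,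
            (srcA j e = v ∧ tgtA j e = w ∧
                g = k * ((qTowerOfSpecialFibreTower X T d S h36 Sigma SigmaHat hsub hne hprime hp TpH HatH hle cuspMeetsH P.admKer_normal_pi).Q j).ι (c₁A j e) * p ∧
                h = k * ((qTowerOfSpecialFibreTower X T d S h36 Sigma SigmaHat hsub hne hprime hp TpH HatH hle cuspMeetsH P.admKer_normal_pi).Q j).ι (c₂A j e) * q) ∨
            (srcA j e = w ∧ tgtA j e = v ∧
                h = k * ((qTowerOfSpecialFibreTower X T d S h36 Sigma SigmaHat hsub hne hprime hp TpH HatH hle cuspMeetsH P.admKer_normal_pi).Q j).ι (c₁A j e) * p ∧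
                g = k * ((qTowerOfSpecialFibreTower X T d S h36 Sigma SigmaHat hsub hne hprime hp TpH HatH hle cuspMeetsH P.admKer_normal_pi).Q j).ι (c₂A j e) * q)) ∨
          (∃ (u : V j) (f : ((qTowerOfSpecialFibreTower X T d S h36 Sigma SigmaHat hsub hne hprime hp TpH HatH hle cuspMeetsH P.admKer_normal_pi).Q j).Hat),
            (∃ (e : EA j) (k : ((qTowerOfSpecialFibreTower X T d S h36 Sigma SigmaHat hsub hne hprime hp TpH HatH hle cuspMeetsH P.admKer_normal_pi).Q j).Hat),
              ∃ p ∈ ((Dd j).vertGp (srcA j e)).map ((qTowerOfSpecialFibreTower X T d S h36 Sigma SigmaHat hsub hne hprime hp TpH HatH hle cuspMeetsH P.admKer_normal_pi).Q j).ι,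
              ∃ q ∈ ((Dd j).vertGp (tgtA j e)).map ((qTowerOfSpecialFibreTower X T d S h36 Sigma SigmaHat hsub hne hprime hp TpH HatH hle cuspMeetsH P.admKer_normal_pi).Q j).ι,
              (srcA j e = v ∧ tgtA j e = u ∧
                  g = k * ((qTowerOfSpecialFibreTower X T d S h36 Sigma SigmaHat hsub hne hprime hp TpH HatH hle cuspMeetsH P.admKer_normal_pi).Q j).ι (c₁A j e) * p ∧
                  f = k * ((qTowerOfSpecialFibreTower X T d S h36 Sigma SigmaHat hsub hne hprime hp TpH HatH hle cuspMeetsH P.admKer_normal_pi).Q j).ι (c₂A j e) * q) ∨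
              (srcA j e = u ∧ tgtA j e = v ∧
                  f = k * ((qTowerOfSpecialFibreTower X T d S h36 Sigma SigmaHat hsub hne hprime hp TpH HatH hle cuspMeetsH P.admKer_normal_pi).Q j).ι (c₁A j e) * p ∧
                  g = k * ((qTowerOfSpecialFibreTower X T d S h36 Sigma SigmaHat hsub hne hprime hp TpH HatH hle cuspMeetsH P.admKer_normal_pi).Q j).ι (c₂A j e) * q)) ∧
            (∃ (e : EA j) (k : ((qTowerOfSpecialFibreTower X T d S h36 Sigma SigmaHat hsub hne hprime hp TpH HatH hle cuspMeetsH P.admKer_normal_pi).Q j).Hat),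
              ∃ p ∈ ((Dd j).vertGp (srcA j e)).map ((qTowerOfSpecialFibreTower X T d S h36 Sigma SigmaHat hsub hne hprime hp TpH HatH hle cuspMeetsH P.admKer_normal_pi).Q j).ι,
              ∃ q ∈ ((Dd j).vertGp (tgtA j e)).map ((qTowerOfSpecialFibreTower X T d S h36 Sigma SigmaHat hsub hne hprime hp TpH HatH hle cuspMeetsH P.admKer_normal_pi).Q j).ι,
              (srcA j e = u ∧ tgtA j e = w ∧
                  f = k * ((qTowerOfSpecialFibreTower X T d S h36 Sigma SigmaHat hsub hne hprime hp TpH HatH hle cuspMeetsH P.admKer_normal_pi).Q j).ι (c₁A j e) * p ∧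
                  h = k * ((qTowerOfSpecialFibreTower X T d S h36 Sigma SigmaHat hsub hne hprime hp TpH HatH hle cuspMeetsH P.admKer_normal_pi).Q j).ι (c₂A j e) * q) ∨
              (srcA j e = w ∧ tgtA j e = u ∧
                  h = k * ((qTowerOfSpecialFibreTower X T d S h36 Sigma SigmaHat hsub hne hprime hp TpH HatH hle cuspMeetsH P.admKer_normal_pi).Q j).ι (c₁A j e) * p ∧
                  f = k * ((qTowerOfSpecialFibreTower X T d S h36 Sigma SigmaHat hsub hne hprime hp TpH HatH hle cuspMeetsH P.admKer_normal_pi).Q j).ι (c₂A j e) * q)))) :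
    ∀ (j : ℕ) (Λ : Subgroup X.PiTemp), IsCompact (Λ : Set X.PiTemp) → Λ ≠ ⊥ →
      IsOpen (Λ.map X.augGK.toMonoidHom : Set X.GK) →
      ∀ (v w : V j) (g h γ : ((qTowerOfSpecialFibreTower X T d S h36 Sigma SigmaHat hsub hne hprime hp TpH HatH hle cuspMeetsH P.admKer_normal_pi).Q j).Hat),
        MulAut.conj γ • Λ.map (((qTowerOfSpecialFibreTower X T d S h36 Sigma SigmaHat hsub hne hprime hp TpH HatH hle cuspMeetsH P.admKer_normal_pi).qhat j).comp X.toHat.toMonoidHom) ≤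
            MulAut.conj g • ((Dd j).vertGp v).map ((qTowerOfSpecialFibreTower X T d S h36 Sigma SigmaHat hsub hne hprime hp TpH HatH hle cuspMeetsH P.admKer_normal_pi).Q j).ι →
        MulAut.conj γ • Λ.map (((qTowerOfSpecialFibreTower X T d S h36 Sigma SigmaHat hsub hne hprime hp TpH HatH hle cuspMeetsH P.admKer_normal_pi).qhat j).comp X.toHat.toMonoidHom) ≤
            MulAut.conj h • ((Dd j).vertGp w).map ((qTowerOfSpecialFibreTower X T d S h36 Sigma SigmaHat hsub hne hprime hp TpH HatH hle cuspMeetsH P.admKer_normal_pi).Q j).ι →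
          g⁻¹ * h ∈ ((qTowerOfSpecialFibreTower X T d S h36 Sigma SigmaHat hsub hne hprime hp TpH HatH hle cuspMeetsH P.admKer_normal_pi).Q j).ι.range :=
  fun j Λ hΛc hΛne hΛo v w g h γ hg hh =>
    inv_mul_mem_range_of_cosetTreeNear _ (fun u => ((Dd j).vertGp u).map _) (fun _ => Subgroup.map_le_range _ _)
      (srcA j) (tgtA j) (c₁A j) (c₂A j) (hA3ar j Λ hΛc hΛne hΛo v w g h γ hg hh)

/-- **The frame one-call with `hA3ar_j ↦ (A3′)_j`**: [IUTchI] Prop. 2.4 (i)(ii)(iii) ∧ Cor. 2.5 AS TYPED at the genuine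
𝔛-datum over `P` — abc-iut-L5-t11's `prop24_cor25_ofPiData_byName_noRF_frame` (p493190) at the node datum
`E⋆_j := V j × V j × Π^tp_j`, its (A3-arith)_j binder supplied from the E-free law (A3′)_j
(`cosetTreeNear_of_inv_mul_mem_range`).  LAW list (6, as p493190): `hTF · hNN_i · hab · hadm · hI_j^frame · (A3′)_j`;
the five node-data binders `EA srcA tgtA c₁A c₂A` are gone.
([IUTchI] Prop 2.4, Cor 2.5 pp.50-51) [claim: Mochizuki2012, status: disputed] -/
theorem prop24_cor25_ofPiData_byName_noRF_frame_A3prime (P : SpecialFibreTower.PiData X d S T)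
    (x : {x : X.Pt // X.IsCusp x})
    (hTF : ∀ H : Subgroup X.DeltaHat, IsOpen (H : Set X.DeltaHat) →
      ∀ (h : H) (n : ℕ), n ≠ 0 →
        SigmaCharDetects Set.univ H h → SigmaCharDetects Set.univ H (h ^ n))
    (G : ∀ i, PSCDatum (levelGraph X T Sigma SigmaHat hsub hne hprime i).Hat)
    (hNN : ∀ i, (G i).VerticialIntersectionNear)
    (σ : ∀ i, (T.Gc i).graph.Vertex ≃ (G i).graph.V) (Λv : ∀ i, (G i).graph.V → Subgroup (T.chart i).G)
    (hvert : ∀ i (v : (T.Gc i).graph.Vertex), Λv i (σ i v) ∈ verticialSubgroups (T.chart i) v)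
    (hΛv : ∀ i v, (Λv i v).map (levelGraph X T Sigma SigmaHat hsub hne hprime i).ι = (G i).vertGp v)
    (src tgt : ∀ i, (G i).graph.N → (G i).graph.V) (c₁ c₂ : ∀ i, (G i).graph.N → (T.chart i).G)
    (hends : ∀ i e, (G i).graph.nodeEnds e = s(src i e, tgt i e))
    (h₁ : ∀ i e, (G i).nodeGp e ≤
      MulAut.conj ((levelGraph X T Sigma SigmaHat hsub hne hprime i).ι (c₁ i e)) • (G i).vertGp (src i e))
    (h₂ : ∀ i e, (G i).nodeGp e ≤
      MulAut.conj ((levelGraph X T Sigma SigmaHat hsub hne hprime i).ι (c₂ i e)) • (G i).vertGp (tgt i e))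
    (hloop : ∀ i e, src i e = tgt i e → (c₁ i e)⁻¹ * c₂ i e ∉ Λv i (src i e))
    (hab : ∀ (i : ℕ) (A : Type) [CommGroup A] [Finite A] (χ : T.N i →* A),
      IsOpen ((χ.ker : Subgroup (T.N i)) : Set (T.N i)) →
      (∀ q : ℕ, q.Prime → q ∣ Nat.card A → q ∈ Sigma) → (T.adm i).toMonoidHom.ker ≤ χ.ker)
    (hadm : ∀ U ∈ 𝓝 (1 : ↥X.DeltaTemp), ∃ j, ((T.admKer j : Subgroup ↥X.DeltaTemp) : Set ↥X.DeltaTemp) ⊆ U)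
    {V B : ℕ → Type*}
    (Dd : ∀ j, DecompositionData ((qTowerOfSpecialFibreTower X T d S h36 Sigma SigmaHat hsub hne hprime hp TpH HatH hle cuspMeetsH P.admKer_normal_pi).Q j).Tp (V j) (B j))
    (hI : ∀ j, haveI := qTower_map_N_normal X d T Sigma SigmaHat hsub hne hprime S h36 hp TpH HatH hle cuspMeetsH P j;
      ArithMaximalCompactStatementI (Dd j)
        (QuotientGroup.mk' (((T.N j).map X.DeltaTemp.subtype).map ((qTowerOfSpecialFibreTower X T d S h36 Sigma SigmaHat hsub hne hprime hp TpH HatH hle cuspMeetsH P.admKer_normal_pi).qtp j))))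
    -- (ii): (A3′)_j — the E-free temperedness transfer
    (hA3' : ∀ (j : ℕ) (Λ : Subgroup X.PiTemp), IsCompact (Λ : Set X.PiTemp) → Λ ≠ ⊥ →
      IsOpen (Λ.map X.augGK.toMonoidHom : Set X.GK) →
      ∀ (v w : V j) (g h γ : ((qTowerOfSpecialFibreTower X T d S h36 Sigma SigmaHat hsub hne hprime hp TpH HatH hle cuspMeetsH P.admKer_normal_pi).Q j).Hat),
        MulAut.conj γ • Λ.map (((qTowerOfSpecialFibreTower X T d S h36 Sigma SigmaHat hsub hne hprime hp TpH HatH hle cuspMeetsH P.admKer_normal_pi).qhat j).comp X.toHat.toMonoidHom) ≤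
            MulAut.conj g • ((Dd j).vertGp v).map ((qTowerOfSpecialFibreTower X T d S h36 Sigma SigmaHat hsub hne hprime hp TpH HatH hle cuspMeetsH P.admKer_normal_pi).Q j).ι →
        MulAut.conj γ • Λ.map (((qTowerOfSpecialFibreTower X T d S h36 Sigma SigmaHat hsub hne hprime hp TpH HatH hle cuspMeetsH P.admKer_normal_pi).qhat j).comp X.toHat.toMonoidHom) ≤
            MulAut.conj h • ((Dd j).vertGp w).map ((qTowerOfSpecialFibreTower X T d S h36 Sigma SigmaHat hsub hne hprime hp TpH HatH hle cuspMeetsH P.admKer_normal_pi).Q j).ι →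
          g⁻¹ * h ∈ ((qTowerOfSpecialFibreTower X T d S h36 Sigma SigmaHat hsub hne hprime hp TpH HatH hle cuspMeetsH P.admKer_normal_pi).Q j).ι.range) :
    ((ofSpecialFibre X d S h36 Sigma SigmaHat hsub hne hprime hp TpH HatH hle cuspMeetsH).Prop24i ∧
      (ofSpecialFibre X d S h36 Sigma SigmaHat hsub hne hprime hp TpH HatH hle cuspMeetsH).Prop24ii ∧
      (ofSpecialFibre X d S h36 Sigma SigmaHat hsub hne hprime hp TpH HatH hle cuspMeetsH).Prop24iii) ∧
    ((ofSpecialFibre X d S h36 Sigma SigmaHat hsub hne hprime hp TpH HatH hle cuspMeetsH).Cor25Decomposition ∧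
      (ofSpecialFibre X d S h36 Sigma SigmaHat hsub hne hprime hp TpH HatH hle cuspMeetsH).Cor25Inertia) :=
  prop24_cor25_ofPiData_byName_noRF_frame X d T Sigma SigmaHat hsub hne hprime S h36 hp TpH HatH hle cuspMeetsH P x
    hTF G hNN σ Λv hvert hΛv src tgt c₁ c₂ hends h₁ h₂ hloop hab hadm Dd hI
    (EA := fun j => V j × V j ×
      ((qTowerOfSpecialFibreTower X T d S h36 Sigma SigmaHat hsub hne hprime hp TpH HatH hle cuspMeetsH P.admKer_normal_pi).Q j).Tp)
    (fun _ e => e.1) (fun _ e => e.2.1) (fun _ _ => 1) (fun _ e => e.2.2)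
    (fun j Λ hΛc hΛne hΛo v w g h γ hg hh =>
      cosetTreeNear_of_inv_mul_mem_range _ (fun u => ((Dd j).vertGp u).map _)
        (hA3' j Λ hΛc hΛne hΛo v w g h γ hg hh))

/-- **The (x′)-keyed one-call with `hA3ar_j ↦ (A3′)_j`** (abc-iut-w4-d058 gen 10's
`prop24_cor25_ofPiData_byName_noRF_frame_of_isFreeOrSurface`, p496462, at `E⋆`): LAW list (5) `hNN_i` (F-2540 BY NAME) ·
`hab` (ORIGIN, G-L5t11g7-1) · `hadm` (GAP G-w4d058-g10-1) · `hI_j^frame` ([SemiAnbd] Thm 5.4 (i) BY NAME at the canonical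
frame) · **(A3′)_j** + the FACT-INSTANCE (x′) `hF`/`e`; node-data binders gone.
([IUTchI] Prop 2.4, Cor 2.5 pp.50-51) [claim: Mochizuki2012, status: disputed] -/
theorem prop24_cor25_ofPiData_byName_noRF_frame_of_isFreeOrSurface_A3prime (P : SpecialFibreTower.PiData X d S T)
    (x : {x : X.Pt // X.IsCusp x})
    {F : Type} [Group F] (hF : IsFreeOrSurface F) (e : X.DeltaHat ≃ₜ* profiniteCompletion F)
    (G : ∀ i, PSCDatum (levelGraph X T Sigma SigmaHat hsub hne hprime i).Hat)
    (hNN : ∀ i, (G i).VerticialIntersectionNear)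
    (σ : ∀ i, (T.Gc i).graph.Vertex ≃ (G i).graph.V) (Λv : ∀ i, (G i).graph.V → Subgroup (T.chart i).G)
    (hvert : ∀ i (v : (T.Gc i).graph.Vertex), Λv i (σ i v) ∈ verticialSubgroups (T.chart i) v)
    (hΛv : ∀ i v, (Λv i v).map (levelGraph X T Sigma SigmaHat hsub hne hprime i).ι = (G i).vertGp v)
    (src tgt : ∀ i, (G i).graph.N → (G i).graph.V) (c₁ c₂ : ∀ i, (G i).graph.N → (T.chart i).G)
    (hends : ∀ i e, (G i).graph.nodeEnds e = s(src i e, tgt i e))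
    (h₁ : ∀ i e, (G i).nodeGp e ≤
      MulAut.conj ((levelGraph X T Sigma SigmaHat hsub hne hprime i).ι (c₁ i e)) • (G i).vertGp (src i e))
    (h₂ : ∀ i e, (G i).nodeGp e ≤
      MulAut.conj ((levelGraph X T Sigma SigmaHat hsub hne hprime i).ι (c₂ i e)) • (G i).vertGp (tgt i e))
    (hloop : ∀ i e, src i e = tgt i e → (c₁ i e)⁻¹ * c₂ i e ∉ Λv i (src i e))
    (hab : ∀ (i : ℕ) (A : Type) [CommGroup A] [Finite A] (χ : T.N i →* A),
      IsOpen ((χ.ker : Subgroup (T.N i)) : Set (T.N i)) →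
      (∀ q : ℕ, q.Prime → q ∣ Nat.card A → q ∈ Sigma) → (T.adm i).toMonoidHom.ker ≤ χ.ker)
    (hadm : ∀ U ∈ 𝓝 (1 : ↥X.DeltaTemp), ∃ j, ((T.admKer j : Subgroup ↥X.DeltaTemp) : Set ↥X.DeltaTemp) ⊆ U)
    {V B : ℕ → Type*}
    (Dd : ∀ j, DecompositionData ((qTowerOfSpecialFibreTower X T d S h36 Sigma SigmaHat hsub hne hprime hp TpH HatH hle cuspMeetsH P.admKer_normal_pi).Q j).Tp (V j) (B j))
    (hI : ∀ j, haveI := qTower_map_N_normal X d T Sigma SigmaHat hsub hne hprime S h36 hp TpH HatH hle cuspMeetsH P j;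
      ArithMaximalCompactStatementI (Dd j)
        (QuotientGroup.mk' (((T.N j).map X.DeltaTemp.subtype).map ((qTowerOfSpecialFibreTower X T d S h36 Sigma SigmaHat hsub hne hprime hp TpH HatH hle cuspMeetsH P.admKer_normal_pi).qtp j))))
    (hA3' : ∀ (j : ℕ) (Λ : Subgroup X.PiTemp), IsCompact (Λ : Set X.PiTemp) → Λ ≠ ⊥ →
      IsOpen (Λ.map X.augGK.toMonoidHom : Set X.GK) →
      ∀ (v w : V j) (g h γ : ((qTowerOfSpecialFibreTower X T d S h36 Sigma SigmaHat hsub hne hprime hp TpH HatH hle cuspMeetsH P.admKer_normal_pi).Q j).Hat),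
        MulAut.conj γ • Λ.map (((qTowerOfSpecialFibreTower X T d S h36 Sigma SigmaHat hsub hne hprime hp TpH HatH hle cuspMeetsH P.admKer_normal_pi).qhat j).comp X.toHat.toMonoidHom) ≤
            MulAut.conj g • ((Dd j).vertGp v).map ((qTowerOfSpecialFibreTower X T d S h36 Sigma SigmaHat hsub hne hprime hp TpH HatH hle cuspMeetsH P.admKer_normal_pi).Q j).ι →
        MulAut.conj γ • Λ.map (((qTowerOfSpecialFibreTower X T d S h36 Sigma SigmaHat hsub hne hprime hp TpH HatH hle cuspMeetsH P.admKer_normal_pi).qhat j).comp X.toHat.toMonoidHom) ≤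
            MulAut.conj h • ((Dd j).vertGp w).map ((qTowerOfSpecialFibreTower X T d S h36 Sigma SigmaHat hsub hne hprime hp TpH HatH hle cuspMeetsH P.admKer_normal_pi).Q j).ι →
          g⁻¹ * h ∈ ((qTowerOfSpecialFibreTower X T d S h36 Sigma SigmaHat hsub hne hprime hp TpH HatH hle cuspMeetsH P.admKer_normal_pi).Q j).ι.range) :
    ((ofSpecialFibre X d S h36 Sigma SigmaHat hsub hne hprime hp TpH HatH hle cuspMeetsH).Prop24i ∧
      (ofSpecialFibre X d S h36 Sigma SigmaHat hsub hne hprime hp TpH HatH hle cuspMeetsH).Prop24ii ∧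
      (ofSpecialFibre X d S h36 Sigma SigmaHat hsub hne hprime hp TpH HatH hle cuspMeetsH).Prop24iii) ∧
    ((ofSpecialFibre X d S h36 Sigma SigmaHat hsub hne hprime hp TpH HatH hle cuspMeetsH).Cor25Decomposition ∧
      (ofSpecialFibre X d S h36 Sigma SigmaHat hsub hne hprime hp TpH HatH hle cuspMeetsH).Cor25Inertia) :=
  prop24_cor25_ofPiData_byName_noRF_frame_A3prime X d T Sigma SigmaHat hsub hne hprime S h36 hp TpH HatH hle cuspMeetsH
    P x (hTF_of_isFreeOrSurface X hF e) G hNN σ Λv hvert hΛv src tgt c₁ c₂ hends h₁ h₂ hloop hab hadm Dd hI hA3'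

/-- **The (x)-keyed one-call with `hA3ar_j ↦ (A3′)_j`** (abc-iut-L5-t11 gen 14's `prop24_cor25_ofPiData_byName_noRF_frame_of_freePro`,
p496636, at `E⋆`): LAW list (5) `hNN_i · hab · hadm · hI_j^frame · (A3′)_j` + the FACT-INSTANCE (x)
`hι : IsProSigmaCompletion {q | q.Prime} ι` (`Γ` free; GAP G-w4d052-g6-2); node-data binders gone.
([IUTchI] Prop 2.4, Cor 2.5 pp.50-51) [claim: Mochizuki2012, status: disputed] -/
theorem prop24_cor25_ofPiData_byName_noRF_frame_of_freePro_A3prime (P : SpecialFibreTower.PiData X d S T)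
    (x : {x : X.Pt // X.IsCusp x})
    {Γ : Type*} [Group Γ] [IsFreeGroup Γ] {ι : Γ →* X.DeltaHat} (hι : IsProSigmaCompletion {q | q.Prime} ι)
    (G : ∀ i, PSCDatum (levelGraph X T Sigma SigmaHat hsub hne hprime i).Hat)
    (hNN : ∀ i, (G i).VerticialIntersectionNear)
    (σ : ∀ i, (T.Gc i).graph.Vertex ≃ (G i).graph.V) (Λv : ∀ i, (G i).graph.V → Subgroup (T.chart i).G)
    (hvert : ∀ i (v : (T.Gc i).graph.Vertex), Λv i (σ i v) ∈ verticialSubgroups (T.chart i) v)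
    (hΛv : ∀ i v, (Λv i v).map (levelGraph X T Sigma SigmaHat hsub hne hprime i).ι = (G i).vertGp v)
    (src tgt : ∀ i, (G i).graph.N → (G i).graph.V) (c₁ c₂ : ∀ i, (G i).graph.N → (T.chart i).G)
    (hends : ∀ i e, (G i).graph.nodeEnds e = s(src i e, tgt i e))
    (h₁ : ∀ i e, (G i).nodeGp e ≤
      MulAut.conj ((levelGraph X T Sigma SigmaHat hsub hne hprime i).ι (c₁ i e)) • (G i).vertGp (src i e))
    (h₂ : ∀ i e, (G i).nodeGp e ≤
      MulAut.conj ((levelGraph X T Sigma SigmaHat hsub hne hprime i).ι (c₂ i e)) • (G i).vertGp (tgt i e))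
    (hloop : ∀ i e, src i e = tgt i e → (c₁ i e)⁻¹ * c₂ i e ∉ Λv i (src i e))
    (hab : ∀ (i : ℕ) (A : Type) [CommGroup A] [Finite A] (χ : T.N i →* A),
      IsOpen ((χ.ker : Subgroup (T.N i)) : Set (T.N i)) →
      (∀ q : ℕ, q.Prime → q ∣ Nat.card A → q ∈ Sigma) → (T.adm i).toMonoidHom.ker ≤ χ.ker)
    (hadm : ∀ U ∈ 𝓝 (1 : ↥X.DeltaTemp), ∃ j, ((T.admKer j : Subgroup ↥X.DeltaTemp) : Set ↥X.DeltaTemp) ⊆ U)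
    {V B : ℕ → Type*}
    (Dd : ∀ j, DecompositionData ((qTowerOfSpecialFibreTower X T d S h36 Sigma SigmaHat hsub hne hprime hp TpH HatH hle cuspMeetsH P.admKer_normal_pi).Q j).Tp (V j) (B j))
    (hI : ∀ j, haveI := qTower_map_N_normal X d T Sigma SigmaHat hsub hne hprime S h36 hp TpH HatH hle cuspMeetsH P j;
      ArithMaximalCompactStatementI (Dd j)
        (QuotientGroup.mk' (((T.N j).map X.DeltaTemp.subtype).map ((qTowerOfSpecialFibreTower X T d S h36 Sigma SigmaHat hsub hne hprime hp TpH HatH hle cuspMeetsH P.admKer_normal_pi).qtp j))))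
    (hA3' : ∀ (j : ℕ) (Λ : Subgroup X.PiTemp), IsCompact (Λ : Set X.PiTemp) → Λ ≠ ⊥ →
      IsOpen (Λ.map X.augGK.toMonoidHom : Set X.GK) →
      ∀ (v w : V j) (g h γ : ((qTowerOfSpecialFibreTower X T d S h36 Sigma SigmaHat hsub hne hprime hp TpH HatH hle cuspMeetsH P.admKer_normal_pi).Q j).Hat),
        MulAut.conj γ • Λ.map (((qTowerOfSpecialFibreTower X T d S h36 Sigma SigmaHat hsub hne hprime hp TpH HatH hle cuspMeetsH P.admKer_normal_pi).qhat j).comp X.toHat.toMonoidHom) ≤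
            MulAut.conj g • ((Dd j).vertGp v).map ((qTowerOfSpecialFibreTower X T d S h36 Sigma SigmaHat hsub hne hprime hp TpH HatH hle cuspMeetsH P.admKer_normal_pi).Q j).ι →
        MulAut.conj γ • Λ.map (((qTowerOfSpecialFibreTower X T d S h36 Sigma SigmaHat hsub hne hprime hp TpH HatH hle cuspMeetsH P.admKer_normal_pi).qhat j).comp X.toHat.toMonoidHom) ≤
            MulAut.conj h • ((Dd j).vertGp w).map ((qTowerOfSpecialFibreTower X T d S h36 Sigma SigmaHat hsub hne hprime hp TpH HatH hle cuspMeetsH P.admKer_normal_pi).Q j).ι →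
          g⁻¹ * h ∈ ((qTowerOfSpecialFibreTower X T d S h36 Sigma SigmaHat hsub hne hprime hp TpH HatH hle cuspMeetsH P.admKer_normal_pi).Q j).ι.range) :
    ((ofSpecialFibre X d S h36 Sigma SigmaHat hsub hne hprime hp TpH HatH hle cuspMeetsH).Prop24i ∧
      (ofSpecialFibre X d S h36 Sigma SigmaHat hsub hne hprime hp TpH HatH hle cuspMeetsH).Prop24ii ∧
      (ofSpecialFibre X d S h36 Sigma SigmaHat hsub hne hprime hp TpH HatH hle cuspMeetsH).Prop24iii) ∧
    ((ofSpecialFibre X d S h36 Sigma SigmaHat hsub hne hprime hp TpH HatH hle cuspMeetsH).Cor25Decomposition ∧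
      (ofSpecialFibre X d S h36 Sigma SigmaHat hsub hne hprime hp TpH HatH hle cuspMeetsH).Cor25Inertia) :=
  prop24_cor25_ofPiData_byName_noRF_frame_A3prime X d T Sigma SigmaHat hsub hne hprime S h36 hp TpH HatH hle cuspMeetsH
    P x (hTF_of_isProSigmaCompletion X hι) G hNN σ Λv hvert hΛv src tgt c₁ c₂ hends h₁ h₂ hloop hab hadm Dd hI hA3'

end OfSpecialFibre

end StableCurveTemperedData

end Literature.IUT.HodgeTheaters

end
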